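import Mathlib
import HarnessLib
import Literature.Analysis.FluidPDE.ClassicalSolution
import Literature.Analysis.FluidPDE.ClassicalSolutionRescale
import Literature.Analysis.FluidPDE.ClassicalSolutionRegion
import Literature.Analysis.FluidPDE.ClassicalTopPointCubic
import Literature.Analysis.FluidPDE.CKNInterpolationEstimate
import Literature.Analysis.FluidPDE.SpaceTimeCalculus
import Literature.Analysis.FluidPDE.LocalTypeI

/-!
# Crux `QuarterLogPincer.TypeIQuantSubcubicExp` (stmt-NavierStokesRegularity-24077), line `thin_cascade`:
  the zoom of a cheap cascade is in Albritton–Barker's class on the parabolic balls `Q(0, 2ᵐ)`,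
  `m ≤ K`

Helper file (`--supports stmt-NavierStokesRegularity-24077 --as helper`, lead prover ns-tc-p1) toward the
registered stub `stub_thinObjectExtraction` (skeleton v5), part (3) «`SingularAt` of the zoom limit»,
step 1 of the plan attached to the item (`S2-PLAN-v5-remaining.md`): the compactness-with-persistence
engine `LocalTypeIBlowup.local_typeI_compactness_singular` consumes pairs in Albritton–Barker's class
`IsSuitableWeakSolutionInBall (2^m) 0` for `m ≤ k`.  Here: the zoom `w = ρ • stPull (ρ²) ρ T x₀ u`,
`q = ρ² • stPull (ρ²) ρ T x₀ p` of ONE cheap cascade of length `K` (Tao frame on `[0,T]`, backward life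
`e^{2K}ρ² ≤ T`) is in that class on `Q(0, 2ᵐ)` for every `m ≤ K` (`zoom_isSuitableWeakSolutionInBall`):
the zoomed pair is classical on the preimage time interval (`IsClassicalNSSolutionOn.nsRescale_translate_zero`),
which contains `[−4ᵐ, 0]` because `4ᵐ ≤ e^{2m} ≤ e^{2K}`; classical solutions on the open cylinder
satisfy the interior conditions (`isSuitableWeakSolutionInBall_of_classical'`), and the three global
classes (`sup_t ∫_{B}|w|²`, `∬|∇w|² < ∞`, `q ∈ L^{3/2}`) hold because `w`, `∇w`, `q` are continuous on
the COMPACT closed cylinder `[−4ᵐ,0] × B̄(0,2ᵐ)` (the zoom is smooth up to `s = 0`: the cascade's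
remaining time `τ > 0` is not even needed, the frame is classical on the closed interval `[0,T]`).
The uniform-in-`K` bound of `typeIBound` (step 2, from the 4th stub `UniformScaledEnergy`) is NOT here.

HONEST FRAMING: bookkeeping toward one registered stub of an open crux; nothing about Navier–Stokes
regularity is proved; no summit statement is proved by this file.
-/

noncomputable section

-- the summit-side namespace `Summit.NavierStokesRegularity.NavierStokesRegularity.…` (single-conjunct summit,
-- D-0017) repeats a component by design; the dupNamespace linter would flag every declaration.
set_option linter.dupNamespace false

namespace Summit.NavierStokesRegularity.NavierStokesRegularity.Theorems.ThinCascade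

open MeasureTheory Set Function Metric
open scoped ENNReal NNReal
open Literature.Analysis Literature.Analysis.FluidPDE

/-- `4ᵐ ≤ e^{2m}` (`2 ≤ e`). [folklore] -/
theorem four_pow_le_exp_two_mul (m : ℕ) : (4 : ℝ) ^ m ≤ Real.exp (2 * (m : ℝ)) := by
  have h2 : (2 : ℝ) ≤ Real.exp 1 := by
    have := Real.add_one_le_exp (1 : ℝ)
    norm_num at this
    exact this
  have h4 : (4 : ℝ) ≤ Real.exp 2 := by
    have e : Real.exp 2 = Real.exp 1 ^ 2 := by
      rw [← Real.exp_nat_mul]; norm_num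
    rw [e]
    nlinarith [Real.exp_pos 1]
  calc (4 : ℝ) ^ m ≤ Real.exp 2 ^ m := pow_le_pow_left₀ (by norm_num) h4 m
    _ = Real.exp (2 * (m : ℝ)) := by rw [← Real.exp_nat_mul, mul_comm]

/-- The preimage time set of the zoom is the interval `[−T/ρ², 0]`. [folklore] -/
theorem zoom_timeSet_eq {T ρ : ℝ} (hρ : 0 < ρ) :
    (fun r => T + ρ ^ 2 * r) ⁻¹' Icc 0 T = Icc (-(T / ρ ^ 2)) 0 := by
  have hρ2 : 0 < ρ ^ 2 := by positivity
  ext s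
  simp only [mem_preimage, mem_Icc]
  constructor
  · rintro ⟨h1, h2⟩
    refine ⟨?_, by nlinarith⟩
    rw [neg_le, le_div_iff₀ hρ2]
    nlinarith
  · rintro ⟨h1, h2⟩
    refine ⟨?_, by nlinarith⟩
    rw [neg_le, le_div_iff₀ hρ2] at h1
    nlinarith

/-- **The zoom of a cheap cascade is in Albritton–Barker's class on `Q(0, 2ᵐ)`, `m ≤ K`.**
For a Tao-frame solution `(u, p)` on `[0,T]` with `e^{2K}ρ² ≤ T` (backward life of a cheap cascade of
length `K` and base scale `ρ > 0` centred at `x₀`), the zoomed pair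
`(ρ • stPull (ρ²) ρ T x₀ u, ρ² • stPull (ρ²) ρ T x₀ p)` is a suitable weak solution in the parabolic ball
`Q(0, 2ᵐ)` in the sense of `IsSuitableWeakSolutionInBall`, for every `m ≤ K`. [folklore] -/
theorem zoom_isSuitableWeakSolutionInBall {T ρ : ℝ} {K m : ℕ} (x₀ : EuclideanSpace ℝ (Fin 3))
    {u : ℝ → EuclideanSpace ℝ (Fin 3) → EuclideanSpace ℝ (Fin 3)}
    {p : ℝ → EuclideanSpace ℝ (Fin 3) → ℝ}
    (hcl₀ : IsClassicalNSSolutionOn (Icc 0 T) 1 0 u p)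
    (hρ : 0 < ρ) (hlife : Real.exp (2 * K) * ρ ^ 2 ≤ T) (hm : m ≤ K) :
    IsSuitableWeakSolutionInBall ((2 : ℝ) ^ m) 0 (ρ • stPull (ρ ^ 2) ρ T x₀ u)
      (ρ ^ 2 • stPull (ρ ^ 2) ρ T x₀ p) := by
  set w := ρ • stPull (ρ ^ 2) ρ T x₀ u with hw
  set q := ρ ^ 2 • stPull (ρ ^ 2) ρ T x₀ p with hq
  set R : ℝ := (2 : ℝ) ^ m with hR
  have hR0 : 0 < R := by positivity
  have hρ2 : 0 < ρ ^ 2 := by positivity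
  have hT : 0 < T := lt_of_lt_of_le (by positivity) hlife
  -- the zoomed pair is classical on the preimage time set `S = [−T/ρ², 0]`
  set S : Set ℝ := (fun r => T + ρ ^ 2 * r) ⁻¹' Icc 0 T with hS
  have hcl : IsClassicalNSSolutionOn S 1 0 w q := hcl₀.nsRescale_translate_zero hρ T x₀
  have hSeq : S = Icc (-(T / ρ ^ 2)) 0 := zoom_timeSet_eq hρ
  have hU : UniqueDiffOn ℝ S := by
    rw [hSeq]; exact uniqueDiffOn_Icc (by rw [neg_lt_zero]; positivity)
  -- `[−R², 0] ⊆ S` since `R² = 4ᵐ ≤ e^{2m} ≤ e^{2K}` and `e^{2K}ρ² ≤ T`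
  have hR2 : R ^ 2 ≤ Real.exp (2 * K) := by
    have e : R ^ 2 = (4 : ℝ) ^ m := by rw [hR, ← pow_mul, mul_comm, pow_mul]; norm_num
    rw [e]
    refine (four_pow_le_exp_two_mul m).trans (Real.exp_le_exp.2 ?_)
    exact_mod_cast Nat.mul_le_mul_left 2 hm
  have hIcc : Icc (-R ^ 2) 0 ⊆ S := by
    intro s hs
    rw [hS, mem_preimage, mem_Icc]
    refine ⟨?_, by nlinarith [hs.2]⟩
    have h1 : ρ ^ 2 * (-R ^ 2) ≤ ρ ^ 2 * s := mul_le_mul_of_nonneg_left hs.1 hρ2.le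
    have h2 : ρ ^ 2 * R ^ 2 ≤ T := le_trans (by nlinarith) hlife
    nlinarith
  -- the cylinder, its compact closure, and the region structure
  set Q : Set (ℝ × EuclideanSpace ℝ (Fin 3)) :=
    parabolicCylinder R (0 : ℝ × EuclideanSpace ℝ (Fin 3)) with hQ
  set Kc : Set (ℝ × EuclideanSpace ℝ (Fin 3)) :=
    Icc (-R ^ 2) 0 ×ˢ closedBall (0 : EuclideanSpace ℝ (Fin 3)) R with hKc
  have hKc_cpt : IsCompact Kc := isCompact_Icc.prod (isCompact_closedBall _ _)
  have hQK : Q ⊆ Kc := by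
    intro z hz
    rw [hQ, mem_parabolicCylinder] at hz
    obtain ⟨⟨h1, h2⟩, h3⟩ := hz
    simp only [Prod.fst_zero, Prod.snd_zero, zero_sub] at h1 h2 h3
    exact ⟨⟨h1.le, h2.le⟩, mem_closedBall.2 h3.le⟩
  have hKS : Kc ⊆ S ×ˢ univ := prod_mono hIcc (subset_univ _)
  have hQS : Q ⊆ S ×ˢ univ := hQK.trans hKS
  have hQmeas : MeasurableSet Q := (isOpen_parabolicCylinder _ _).measurableSet
  have hQfin : volume Q < ⊤ := lt_of_le_of_lt (measure_mono hQK) hKc_cpt.measure_lt_top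
  have hreg : IsClassicalNSSolutionOnRegion Q 1 0 w q := by
    have h := hcl.onRegion_inter (isOpen_parabolicCylinder R (0 : ℝ × EuclideanSpace ℝ (Fin 3)))
    rwa [inter_eq_right.2 hQS] at h
  -- bounds on the compact closure
  have hwc : ContinuousOn (uncurry w) Kc := hcl.smooth_velocity.continuousOn.mono hKS
  have hqc : ContinuousOn (uncurry q) Kc := hcl.smooth_pressure.continuousOn.mono hKS
  have hFc : ContinuousOn (fun z : ℝ × EuclideanSpace ℝ (Fin 3) =>
      frobeniusNormSq (fderiv ℝ (w z.1) z.2)) Kc :=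
    (continuous_frobeniusNormSq'.comp_continuousOn
      (hcl.smooth_velocity.continuousOn_fderiv_slice hU)).mono hKS
  obtain ⟨Bw, hBw⟩ := hKc_cpt.exists_bound_of_continuousOn hwc
  obtain ⟨Bq, hBq⟩ := hKc_cpt.exists_bound_of_continuousOn hqc
  obtain ⟨BF, hBF⟩ := hKc_cpt.exists_bound_of_continuousOn hFc
  -- the three global classes
  have hvolB : volume (ball (0 : EuclideanSpace ℝ (Fin 3)) R) < ⊤ := measure_ball_lt_top
  set Cw : ℝ≥0∞ := ENNReal.ofReal (Bw ^ 2) * volume (ball (0 : EuclideanSpace ℝ (Fin 3)) R) with hCw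
  have hCw_fin : Cw ≠ ⊤ := ENNReal.mul_ne_top ENNReal.ofReal_ne_top hvolB.ne
  refine isSuitableWeakSolutionInBall_of_classical' hreg (C := Cw.toNNReal) ?_ ?_ ?_
  · -- `sup_t ∫_{B_R} |w(t)|² ≤ Bw² |B_R|`
    intro t ht
    simp only [Prod.fst_zero, Prod.snd_zero, zero_sub] at ht ⊢
    rw [ENNReal.coe_toNNReal hCw_fin, hCw]
    calc ∫⁻ x in ball (0 : EuclideanSpace ℝ (Fin 3)) R, ‖w t x‖ₑ ^ 2
        ≤ ∫⁻ x in ball (0 : EuclideanSpace ℝ (Fin 3)) R, ENNReal.ofReal (Bw ^ 2) := by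
          refine lintegral_mono_ae ((ae_restrict_iff' measurableSet_ball).2 (ae_of_all _ ?_))
          intro x hx
          have hle : ‖w t x‖ ≤ Bw := hBw (t, x) ⟨⟨ht.1.le, ht.2.le⟩, ball_subset_closedBall hx⟩
          rw [← ofReal_norm, ← ENNReal.ofReal_pow (norm_nonneg _)]
          exact ENNReal.ofReal_le_ofReal (pow_le_pow_left₀ (norm_nonneg _) hle 2)
      _ = ENNReal.ofReal (Bw ^ 2) * volume (ball (0 : EuclideanSpace ℝ (Fin 3)) R) :=
          setLIntegral_const _ _
  · -- `∬_Q |∇w|² < ∞`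
    calc ∫⁻ z in Q, ENNReal.ofReal (frobeniusNormSq (fderiv ℝ (w z.1) z.2))
        ≤ ∫⁻ z in Q, ENNReal.ofReal BF := by
          refine lintegral_mono_ae ((ae_restrict_iff' hQmeas).2 (ae_of_all _ fun z hz => ?_))
          have h := hBF z (hQK hz)
          rw [Real.norm_eq_abs] at h
          exact ENNReal.ofReal_le_ofReal (le_trans (le_abs_self _) h)
      _ = ENNReal.ofReal BF * volume Q := setLIntegral_const _ _
      _ < ⊤ := ENNReal.mul_lt_top ENNReal.ofReal_lt_top hQfin
  · -- `q ∈ L^{3/2}(Q)`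
    haveI : IsFiniteMeasure (volume.restrict Q) :=
      ⟨by rw [Measure.restrict_apply_univ]; exact hQfin⟩
    refine MemLp.of_bound ((hqc.mono hQK).aestronglyMeasurable hQmeas) Bq ?_
    exact (ae_restrict_iff' hQmeas).2 (ae_of_all _ fun z hz => hBq z (hQK hz))

end Summit.NavierStokesRegularity.NavierStokesRegularity.Theorems.ThinCascade

end
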